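import Summits.PneNP.PneNP.Theorems.ChebyshevTracialDesignPseudoMatchingBaseOne
import Summits.PneNP.PneNP.Theorems.ChebyshevTracialDesignPairContainmentEntrywise
import HarnessLib

/-!
# Cell pnp-psdrank, route `ChebyshevTracialDesign`: the pair-containment form is EXACTLY NONPOSITIVE ON AVERAGE OVER THE MATCHINGS in every
# matching-INDEPENDENT direction — `Σ_M Σ_U W(U,M) f(U)·(Σ_p v_p x_p x_{π_M p})² ≤ 0` for every `f ≥ 0` and every fixed `v`
# (crux `TracialDecayExp20`, stmt-PneNP-19878)

Brick 104 (prover g19; MEMO-22 §1). (CG_1') asks `Σ_M sup_{|v_M|≤1} (Σ_U W(U,M) f(U) C_{v_M}(U)²)₊ ≤ e^{−aD}` with the pair-containment form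
`C_v(U) = Σ_p v_p x_p x_{π_M p}` (bricks 98–103). Two things make it hard: the POSITIVE PART (fluctuations over `M`) and the `M`-DEPENDENCE of
the direction `v_M`. This file shows that without both, nothing is left: for a direction `v` that does not depend on `M`, the `M`-SUM of the
form is `≤ 0` EXACTLY, for every nonnegative mask `f` (no upper bound, no degree hypothesis) and every exact design of degree `≥ 2`.
MECHANISM: `C_v(U) = Σ_{(a,b)} (v_a x_a x_b)(U)·1[{a,b} ∈ M]` is a bilinear pairing of a cut-side vector with a matching-side vector of
MATCHING-DEGREE ONE, so `f(U)·C_v(U)² = tr(X_U B_M B_Mᵀ)` with `X_U = f(U)·α_Uα_Uᵀ ⪰ 0` (ARBITRARY psd cut side) and `B_M` of matching-degree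
`≤ 1`; brick `…PseudoMatchingBaseOne` (`sum_levelWeight_trace_nonpos_of_lowDegreeM_one`: matching-side low-degree pricing at degree one,
UNCONDITIONAL via the `(5,1)` certificate of Potechin's pseudo-matching form) prices it `≤ 0`. Equivalently (MEMO-21 §3(b) in the kernel):
`E_M G^f_M = E_U[f·ψψᵀ] ⪰ 0` — the `M`-average of the localised moment matrix is a genuine second-moment matrix.
* `sum_ite_mem_eq_partner` (`Σ_b 1[{a,b} ∈ M]·g(b) = g(π_M a)`), `containment_eq_pairing` (the bilinear form);
* **`sum_containment_sq_nonpos_of_fixed`** — THE STATEMENT; `sum_containment_sq_nonpos_of_fixed'` (the `Σ_M Σ_U` order);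
* **`avg_pairPinned_quadratic_nonpos`**: `Σ_{p,q} v_p v_q·(Σ_M A^f_M(p,q)) ≤ 0` — the `M`-SUMMED pair-pinned design-value matrix
  `Σ_M A^f_M` is negative semidefinite for every mask (its entries are virtually nonpositive one `M` at a time only up to `n⁴γ`, brick 102).
So, with bricks 102/103: sign-coherent directions, the level direction, low-degree masks, and every FIXED direction on `M`-average are priced;
the open part of (CG_1') is the excess of `sup_{v_M}` over fixed `v` — the fluctuation, over `M`, of the negative-part matrix `N^f_M` in
`M`-adapted sign-incoherent directions.
[cite: Potechin2019, Thm. 1.2 (LIPIcs 124, 61:4)] [cite: Grigoriev2001, Lemma 1.4 (PDF p. 8)] [cite: Rothvoss2017, §2 (PDF p. 6)]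
[cite: GriblingDelaatLaurent2019, §5]
Stature: support/instrument (kernel lane, no defs, axioms standard). WHAT THIS IS NOT: nothing on `M`-dependent directions (that is (CG_1')),
no proof or refutation of `TracialDecayExp20`, nothing on psd rank of P_PM(K_n), no P-vs-NP content. Supports stmt-PneNP-19878.
-/

set_option linter.dupNamespace false -- `Summit.PneNP.PneNP.…`: summit = sub-problem (D-0017)

noncomputable section

namespace Summit.PneNP.PneNP.Theorems.ChebyshevTracialDesignPairContainmentAverage

open Finset Matrix Literature.Barriers.PneNP Literature.Combinatorics.Optimization
open Summit.PneNP.PneNP.Theorems.ChebyshevTracialDesignPseudoMatchingBaseOne (sum_levelWeight_trace_nonpos_of_lowDegreeM_one)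

variable {n : ℕ}

/-- Re-indexing the partner through edge membership: `Σ_b 1[{a,b} ∈ M]·g(b) = g(π_M a)`. [folklore] -/
theorem sum_ite_mem_eq_partner (M : PMatch n) (a : Fin n) (g : Fin n → ℝ) :
    ∑ b, (if s(a, b) ∈ M.1 then g b else 0) = g (M.2.partner a) := by
  classical
  have h : ∀ b, (s(a, b) ∈ M.1 ↔ b = M.2.partner a) := fun b =>
    ⟨fun hb => M.2.eq_partner_of_mem hb, fun hb => hb ▸ M.2.mk_partner_mem a⟩
  simp_rw [h]
  rw [Finset.sum_ite_eq' univ (M.2.partner a) g, if_pos (mem_univ _)]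

/-- **The containment form is a cut ⊗ (matching-degree-one) pairing**:
`Σ_p v_p x_p x_{π_M p} = Σ_{(a,b)} (v_a x_a x_b)·1[{a,b} ∈ M]` (pairs indexed by `Fin (n·n)`). [cite: Rothvoss2017, §2 (PDF p. 6)] -/
theorem containment_eq_pairing (U : OddSet n) (M : PMatch n) (v : Fin n → ℝ) :
    ∑ p, v p * ((if p ∈ U.1 then (1 : ℝ) else 0) * (if M.2.partner p ∈ U.1 then (1 : ℝ) else 0)) =
      ∑ i : Fin (n * n), (v (finProdFinEquiv.symm i).1 * ((if (finProdFinEquiv.symm i).1 ∈ U.1 then (1 : ℝ) else 0) *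
          (if (finProdFinEquiv.symm i).2 ∈ U.1 then (1 : ℝ) else 0))) *
        (if s((finProdFinEquiv.symm i).1, (finProdFinEquiv.symm i).2) ∈ M.1 then (1 : ℝ) else 0) := by
  classical
  rw [← finProdFinEquiv.sum_comp]
  simp only [Equiv.symm_apply_apply, Fintype.sum_prod_type]
  refine sum_congr rfl fun a _ => ?_
  rw [← sum_ite_mem_eq_partner M a (fun b => v a * ((if a ∈ U.1 then (1 : ℝ) else 0) * (if b ∈ U.1 then (1 : ℝ) else 0)))]
  refine sum_congr rfl fun b _ => ?_
  split_ifs <;> ring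

/-- **THE PAIR-CONTAINMENT FORM IS NONPOSITIVE ON AVERAGE OVER THE MATCHINGS, IN EVERY FIXED DIRECTION.** Let `n` be even, `(C, w)` an exact
design of degree `D ≥ 2` on the `t`-cuts with `5 ≤ t`, `5 ≤ n − t`, `f : cuts → ℝ_{≥0}` ANY nonnegative mask and `v : Fin n → ℝ` ANY direction
(not depending on `M`). Then `Σ_U Σ_M W(U,M)·f(U)·(Σ_p v_p x_p x_{π_M p})² ≤ 0`.
[cite: Potechin2019, Thm. 1.2 (LIPIcs 124, 61:4)] [cite: Grigoriev2001, Lemma 1.4 (PDF p. 8)] [cite: Rothvoss2017, §2 (PDF p. 6)] -/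
theorem sum_containment_sq_nonpos_of_fixed (hn : Even n) {t T D : ℕ} {Bv : ℝ} {C : Finset ℕ} {w : ℕ → ℝ}
    (hdes : IsExactDesign n t T D Bv C w) (hD : 2 ≤ D) (ht : 5 ≤ t) (hnt : 5 ≤ n - t)
    (f : OddSet n → ℝ) (hf : ∀ U, 0 ≤ f U) (v : Fin n → ℝ) :
    ∑ U : OddSet n, ∑ M : PMatch n, levelWeight n t C w U M *
      (f U * (∑ p, v p * ((if p ∈ U.1 then (1 : ℝ) else 0) * (if M.2.partner p ∈ U.1 then (1 : ℝ) else 0))) ^ 2) ≤ 0 := by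
  classical
  -- the cut-side vectors and the matching-side (degree-one) vectors, indexed by ordered pairs
  set α : OddSet n → Fin (n * n) → ℝ := fun U i => v (finProdFinEquiv.symm i).1 *
    ((if (finProdFinEquiv.symm i).1 ∈ U.1 then (1 : ℝ) else 0) * (if (finProdFinEquiv.symm i).2 ∈ U.1 then (1 : ℝ) else 0)) with hα
  set β : PMatch n → Fin (n * n) → ℝ := fun M i =>
    if s((finProdFinEquiv.symm i).1, (finProdFinEquiv.symm i).2) ∈ M.1 then (1 : ℝ) else 0 with hβ
  have hdot : ∀ (U : OddSet n) (M : PMatch n), ∑ i, α U i * β M i =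
      ∑ p, v p * ((if p ∈ U.1 then (1 : ℝ) else 0) * (if M.2.partner p ∈ U.1 then (1 : ℝ) else 0)) := fun U M =>
    (containment_eq_pairing U M v).symm
  set X : OddSet n → Matrix (Fin (n * n)) (Fin (n * n)) ℝ := fun U => f U • vecMulVec (α U) (α U) with hX
  set B : PMatch n → Matrix (Fin (n * n)) (Fin 1) ℝ := fun M => Matrix.of fun i _ => β M i with hB
  have hXpsd : ∀ U, (X U).PosSemidef := fun U => by
    have h := posSemidef_vecMulVec_self_star (α U)
    rw [star_trivial] at h
    exact h.smul (hf U)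
  have hBlow : IsLowDegreeM n 1 B := fun i j => by
    change (fun M : PMatch n => β M i) ∈ _
    refine Submodule.subset_span ⟨⟨{s((finProdFinEquiv.symm i).1, (finProdFinEquiv.symm i).2)}, by simp⟩, ?_⟩
    funext M
    simp only [hβ, Finset.singleton_subset_iff]
  have htr : ∀ (U : OddSet n) (M : PMatch n), (X U * (B M * (B M)ᵀ)).trace = f U * (∑ i, α U i * β M i) ^ 2 := by
    intro U M
    simp only [hX, hB, Matrix.trace, Matrix.diag_apply, Matrix.mul_apply, Matrix.transpose_apply, Matrix.smul_apply, vecMulVec_apply,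
      Matrix.of_apply, smul_eq_mul, Fin.sum_univ_one]
    rw [sq, sum_mul_sum, mul_sum]
    refine sum_congr rfl fun i _ => ?_
    rw [mul_sum]
    refine sum_congr rfl fun j _ => ?_
    ring
  have h := sum_levelWeight_trace_nonpos_of_lowDegreeM_one hn hdes hD ht hnt X hXpsd B hBlow
  simp_rw [htr, hdot] at h
  exact h

/-- The same with the sums in the order `Σ_M Σ_U`. [cite: Potechin2019, Thm. 1.2 (LIPIcs 124, 61:4)] -/
theorem sum_containment_sq_nonpos_of_fixed' (hn : Even n) {t T D : ℕ} {Bv : ℝ} {C : Finset ℕ} {w : ℕ → ℝ}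
    (hdes : IsExactDesign n t T D Bv C w) (hD : 2 ≤ D) (ht : 5 ≤ t) (hnt : 5 ≤ n - t)
    (f : OddSet n → ℝ) (hf : ∀ U, 0 ≤ f U) (v : Fin n → ℝ) :
    ∑ M : PMatch n, ∑ U : OddSet n, levelWeight n t C w U M *
      (f U * (∑ p, v p * ((if p ∈ U.1 then (1 : ℝ) else 0) * (if M.2.partner p ∈ U.1 then (1 : ℝ) else 0))) ^ 2) ≤ 0 := by
  rw [sum_comm]; exact sum_containment_sq_nonpos_of_fixed hn hdes hD ht hnt f hf v

/-- **THE `M`-SUMMED PAIR-PINNED DESIGN-VALUE MATRIX IS NEGATIVE SEMIDEFINITE**: for every nonnegative mask `f` and every `v`,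
`Σ_{p,q} v_p v_q·Σ_M (Σ_U W(U,M) f(U) x_p x_{π_M p} x_q x_{π_M q}) ≤ 0`. [cite: Potechin2019, Thm. 1.2 (LIPIcs 124, 61:4)]
[cite: Grigoriev2001, Lemma 1.4 (PDF p. 8)] -/
theorem avg_pairPinned_quadratic_nonpos (hn : Even n) {t T D : ℕ} {Bv : ℝ} {C : Finset ℕ} {w : ℕ → ℝ}
    (hdes : IsExactDesign n t T D Bv C w) (hD : 2 ≤ D) (ht : 5 ≤ t) (hnt : 5 ≤ n - t)
    (f : OddSet n → ℝ) (hf : ∀ U, 0 ≤ f U) (v : Fin n → ℝ) :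
    ∑ p, ∑ q, v p * v q * ∑ M : PMatch n, ∑ U : OddSet n, levelWeight n t C w U M *
      (f U * (((if p ∈ U.1 then (1 : ℝ) else 0) * (if M.2.partner p ∈ U.1 then (1 : ℝ) else 0)) *
        ((if q ∈ U.1 then (1 : ℝ) else 0) * (if M.2.partner q ∈ U.1 then (1 : ℝ) else 0)))) ≤ 0 := by
  have h := sum_containment_sq_nonpos_of_fixed' hn hdes hD ht hnt f hf v
  have hid : ∀ M : PMatch n, ∑ U : OddSet n, levelWeight n t C w U M *
      (f U * (∑ p, v p * ((if p ∈ U.1 then (1 : ℝ) else 0) * (if M.2.partner p ∈ U.1 then (1 : ℝ) else 0))) ^ 2) =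
      ∑ p, ∑ q, v p * v q * ∑ U : OddSet n, levelWeight n t C w U M *
        (f U * (((if p ∈ U.1 then (1 : ℝ) else 0) * (if M.2.partner p ∈ U.1 then (1 : ℝ) else 0)) *
          ((if q ∈ U.1 then (1 : ℝ) else 0) * (if M.2.partner q ∈ U.1 then (1 : ℝ) else 0)))) := fun M =>
    ChebyshevTracialDesignPairContainmentEntrywise.containment_sq_eq_sum_pairPinned (levelWeight n t C w) f M v
  set A : PMatch n → Fin n → Fin n → ℝ := fun M p q => ∑ U : OddSet n, levelWeight n t C w U M *
        (f U * (((if p ∈ U.1 then (1 : ℝ) else 0) * (if M.2.partner p ∈ U.1 then (1 : ℝ) else 0)) *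
          ((if q ∈ U.1 then (1 : ℝ) else 0) * (if M.2.partner q ∈ U.1 then (1 : ℝ) else 0)))) with hA
  change ∑ p, ∑ q, v p * v q * ∑ M : PMatch n, A M p q ≤ 0
  change ∀ M : PMatch n, _ = ∑ p, ∑ q, v p * v q * A M p q at hid
  calc ∑ p, ∑ q, v p * v q * ∑ M : PMatch n, A M p q
      = ∑ p, ∑ q, ∑ M : PMatch n, v p * v q * A M p q :=
        sum_congr rfl fun p _ => sum_congr rfl fun q _ => by rw [mul_sum]
    _ = ∑ p, ∑ M : PMatch n, ∑ q, v p * v q * A M p q := sum_congr rfl fun p _ => sum_comm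
    _ = ∑ M : PMatch n, ∑ p, ∑ q, v p * v q * A M p q := sum_comm
    _ = ∑ M : PMatch n, ∑ U : OddSet n, levelWeight n t C w U M *
        (f U * (∑ p, v p * ((if p ∈ U.1 then (1 : ℝ) else 0) * (if M.2.partner p ∈ U.1 then (1 : ℝ) else 0))) ^ 2) :=
        sum_congr rfl fun M _ => (hid M).symm
    _ ≤ 0 := h

end Summit.PneNP.PneNP.Theorems.ChebyshevTracialDesignPairContainmentAverage
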